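import Summits.BirchSwinnertonDyer.BirchSwinnertonDyer.Theorems.ByReductionTypeAtTwoOrdKatoHalfAtTwoIsoRelaxedMuDoorPosDisc
import Literature.NumberTheory.EllipticCurves.IwasawaSelmerRelaxedAtInfinity
import Literature.NumberTheory.EllipticCurves.IwasawaSelmerDualFunctorialityProofs
import HarnessLib

/-!
# Route ByReductionTypeAtTwo, crux `OrdKatoHalfAtTwoIso` (stmt-BirchSwinnertonDyer-19573), cell [`ρ̄₂` onto ∧ `0 < Δ`]
# (PAIR child 24097): the two DISPLAYED TEXTS of the RELAXED-GENUINE road — R⁺ (Kato's GENUINE zeta classes in relaxed-at-∞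
# Coleman coordinates) and Aʳ (the archimedean `Λ/2`) — pinned to the Literature carrier `SelmerDualDataRelaxedInf`, with the
# restriction `X^{rel} ↠ X` constructed, and the doors: conjunct / PAIR child BY NAME (definitions + theorems; nothing asserted)

Seat `cruxlead-stmt-BirchSwinnertonDyer-19573-w2` GEN 5 (prover WIDTH under the LEAD lineage `cruxlead-19573`; HOME
`run/shared/lean/pub/bsd-2adic/`; pen RC-406 (2) ★ lane «RELAXED-GENUINE» (a)–(d), RC-410 «absorbs», RC-412). Sequel of
`…RelaxedMuDoor` (p703778, the relaxed `μ`-door per datum) / `…RelaxedMuDoorPosDisc` (p704497, the cell door with an `∃`-Type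
relaxed module) and of the Literature typing `IwasawaSelmerRelaxedAtInfinity` (p703162: `selmerInftyRelaxedInf`,
`SelmerDualDataRelaxedInf` = `X^{rel ∞}(E/K_∞)`, constructed existence). HONEST FRAMING (cell bsd-2adic): BSD is not proved by any of
this; neither the crux nor its `0 < Δ` conjunct nor the PAIR child is proved here. TWO DEFINITIONS of OPEN statements displayed BY
NAME (`@[conjecture]`, R-B77: beyond-print readings are Summits-side definitions consumed by name; NOT Literature facts, nothing
asserted) + theorems: the forced `Λ`-action and the restriction `q : X^{rel} ↠ X` (kernel = `(Sel^{rel}/Sel)^∨`) for the pinned duals,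
and the doors.

THE POINT (pen RC-406 (2) «if (d) elaborates, the 0 < Δ cells' memo-tier input becomes the SAME currency as the Δ < 0 cell's»): on the
cell the Euler-system mechanism was «void as typed» because every GENUINE Kato class is booked at `2·L₂^{tree}` (F-27a) — the (ε)
re-cut P⁺ therefore reads HALF classes (memo tier, witnessed only by the half class `y′` of triage Thm E/F). The relaxed road keeps
the GENUINE classes and moves the factor `2 = c_∞` into the Selmer structure: R⁺ below is VERBATIM the `Δ < 0` reading F1μι⁻
(`ZetaColemanMuIotaNegDiscAtTwo`, p693557) with the carriers `(D, Y)` replaced by the relaxed-at-`∞` `(Dr, Yr)` and the image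
clause at `2·G₁`; its Kato witness is KATO'S OWN SYSTEM ([ASP] Thm 6.9 (ii): the corestricted zeta module is trivial at the real
places). Aʳ is [ASP] Thm 6.9 (i) (`(Sel^{rel}/Sel)^∨ ≅ H¹(ℝ, T₂E)⟦Γ⟧ = Λ/2` on `0 < Δ`; reserve tier, UPHELD; the kernel uses only
`Λ/2 ↪`). With relaxed (A₂) ⟸ Iw⁺ + Lim 2017 Thm 3.5 at `2` UPSTAIRS (named fact) — triage THEOREM H (H2), kernel (p704497) — the
conjunct follows with NO half class and NO Euler-system bound at `2` (both triage seats: «absorbs», RC-410).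

* §1 `relaxedSelmerDual_toDual_smul` — the `Λ`-action of ANY `SelmerDualDataRelaxedInf` is forced (canonical `IsLocNil.smulFun`).
* §2 `exists_relaxedSelmerRestrict` / `_unique` / `_surjective` / `_eq_zero_iff` / `lengthAt_relaxedSelmer_eq_ker_add` — the
  restriction `q : X^{rel ∞} → X` (dual of `Sel ≤ Sel^{rel ∞}`; the tree's generic transpose `IwasawaDual.dualLinearMap`), onto by the
  injectivity of `ℚ/ℤ`, kernel = characters vanishing on `Sel`.
* §3 TEXTS: R⁺ `RelaxedZetaColemanIotaPosDiscAtTwo`, Aʳ `ArchimedeanLambdaModTwoOrdAtTwo` (+ `Iff.rfl`).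
* §4 DOORS: `relaxedColemanData_of_relaxedZeta_of_arch` (R⁺ + Aʳ ⟹ the `∃`-Type relaxed data of p704497, `Xr := X^{rel}` of the
  CONSTRUCTED datum, `e = 1`), `ordKatoHalfAtTwoIsoPosDisc_of_relaxedZeta_of_arch_of_relaxedConjA`,
  `…_of_lim_upstairs_of_classicalMu` (R⁺ + Aʳ + Iw⁺ + Lim@2-upstairs + Abbes–Ullmo + Kato 17.4 ⇒ the conjunct BY NAME),
  `ordKatoFineZetaAtTwoResidue_of_negDisc_of_relaxedZeta_of_arch` (PAIR child 24097 BY NAME: F1μι⁻ + the relaxed road).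

References: [Kato2004Asterisque] Thm 12.6, 16.2, 16.6, Prop 17.11, §17.13; reserve [ASP] §6.6 Thm 6.9 (i)(ii)(iv) (UPHELD 2026-08-08);
[GreenbergLNM1716] §1 p. 60, §4 Lemma 4.6 (pp. 105–107), Prop 5.8; [CoatesSujatha2005] (A); [Lim2017FineSelmer] Thm 3.5, Lemma 3.2;
[Washington1997] §13.2; MEMO-7 (1.1)(h); triage r1-1 F-31, r1-2 GEN 36 §C/§G; tree p693557, p699544, p700774, p703162, p703778, p704497,
`…FineRoadRelaxedFine` / `…FineRoadLimRelUpstairs` (bsd-f1-sign2), `IwasawaSelmerDualFunctorialityProofs` (t42).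
-/

set_option autoImplicit false
set_option linter.dupNamespace false

noncomputable section

open scoped Classical MatrixGroups ModularForm NumberField
open CongruenceSubgroup WeierstrassCurve Field IsDedekindDomain NumberField
open Literature.NumberTheory.GaloisRepresentations
open Literature.NumberTheory.GaloisCohomology
open Literature.NumberTheory.EllipticCurves Literature.NumberTheory.EllipticCurves.ModularForms
open Literature.NumberTheory.EllipticCurves.Kato2004
  Literature.NumberTheory.EllipticCurves.Kato2004.EulerSystemValues
open Literature.NumberTheory.EllipticCurves.Rank1Residual
open Literature.NumberTheory.EllipticCurves.Greenberg1999
open Literature.NumberTheory.IwasawaTheory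
open Summit.BirchSwinnertonDyer.BirchSwinnertonDyer.Theorems.Rank1ResidualX1Defs
  Summit.BirchSwinnertonDyer.BirchSwinnertonDyer.Rank1Residual
  Summit.BirchSwinnertonDyer.BirchSwinnertonDyer.Rank1Residual.CoreAssembly
open Summit.BirchSwinnertonDyer.Rank1Residual Summit.BirchSwinnertonDyer.Rank1Residual.X5
  Summit.BirchSwinnertonDyer.Rank1Residual.X1.MuLambda
open Summit.BirchSwinnertonDyer.BirchSwinnertonDyer.Theorems.OrdKatoOptimalAtTwo
  Summit.BirchSwinnertonDyer.BirchSwinnertonDyer.Theorems.OrdKatoIntAtTwo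
open Summit.BirchSwinnertonDyer.BirchSwinnertonDyer.Theses.ByReductionTypeAtTwo
open Summit.BirchSwinnertonDyer.BirchSwinnertonDyer.Theorems.AlignedTransportAtTwoFineRoad

namespace Summit.BirchSwinnertonDyer.BirchSwinnertonDyer.Theorems.SteinbergFibreAtTwo

/-! ## §1 The `Λ`-action of a `SelmerDualDataRelaxedInf` is forced -/

section Forced

variable {K : Type} [Field K] [NumberField K] (W : WeierstrassCurve K) {p : ℕ} [Fact p.Prime]
  (κ : ZpExtension K p) {γ : Field.absoluteGaloisGroup K}

/-- Induction carrier for `relaxedSelmerDual_toDual_smul`: on classes `s ∈ Sel^{rel ∞}(K_∞)` killed by `ψ^N`, `ψ = conj_γ − 1`,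
the action of ANY `W.SelmerDualDataRelaxedInf κ γ` read through `toDual` is the canonical finite sum `IsLocNil.smulFun` (peel off the
constant term `f = T·g + C a`; relaxed copy of `SelmerDualData.toDual_smul_apply_of_pow_apply_eq_zero`).
[cite: GreenbergLNM1716, §1 p. 60 (after Conj. 1.3)] -/
theorem relaxedSelmerDual_toDual_smul_apply_of_pow_apply_eq_zero (hγ : κ.IsTopGenerator γ)
    (D : W.SelmerDualDataRelaxedInf κ γ) (N : ℕ) :
    ∀ (s : W.selmerInftyRelaxedInf κ), ((W.conjSelmerInftyRelaxedInf κ γ - 1) ^ N) s = 0 →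
      ∀ (f : IwasawaAlgebra p) (x : D.X),
        D.toDual (f • x) s = (W.isLocNil_conjSelmerInftyRelaxedInf_sub_one κ hγ).smulFun f (D.toDual x) s := by
  set h := W.isLocNil_conjSelmerInftyRelaxedInf_sub_one κ hγ
  set ψ : AddMonoid.End (W.selmerInftyRelaxedInf κ) := W.conjSelmerInftyRelaxedInf κ γ - 1 with hψ
  induction N with
  | zero =>
    intro s hs f x
    rw [pow_zero, AddMonoid.End.one_apply] at hs
    rw [hs, map_zero, map_zero]
  | succ N ih =>
    intro s hs f x
    obtain ⟨k, hk⟩ := h.torsion s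
    have hψs : (ψ ^ N) (ψ s) = 0 := by
      rwa [pow_succ, AddMonoid.End.coe_mul, Function.comp_apply] at hs
    have hψeval : ∀ y : D.X, D.toDual y (ψ s) =
        D.toDual y ⟨W.conjH1 p κ.kerSubgroup γ s, W.conjH1_mem_selmerInftyRelaxedInf κ γ s.2⟩ - D.toDual y s :=
      fun y ↦ by
        rw [hψ, IwasawaDual.End_sub_apply, AddMonoid.End.one_apply, map_sub]
        rfl
    set g : IwasawaAlgebra p := PowerSeries.mk fun n ↦ PowerSeries.coeff (n + 1) f
    set a : ℤ_[p] := PowerSeries.constantCoeff f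
    have hf : f = PowerSeries.X * g + PowerSeries.C a := PowerSeries.eq_X_mul_shift_add_const f
    have lhs : D.toDual (f • x) s = D.toDual (g • x) (ψ s) + (PadicInt.toZModPow k a).val • D.toDual x s := by
      conv_lhs => rw [hf]
      rw [add_smul, mul_smul, map_add, AddMonoidHom.add_apply, D.toDual_T_smul, D.toDual_C_smul a x s k hk, hψeval]
    have rhs : h.smulFun f (D.toDual x) s =
        h.smulFun g (D.toDual x) (ψ s) + (PadicInt.toZModPow k a).val • D.toDual x s := by
      conv_lhs => rw [hf]
      rw [h.smulFun_add_left, h.smulFun_mul_left, AddMonoidHom.add_apply, h.smulFun_X_apply,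
        h.smulFun_C_apply a (D.toDual x) hk]
    rw [lhs, rhs, ih (ψ s) hψs g x]

/-- **The `Λ`-action of a `SelmerDualDataRelaxedInf` is forced**: for ANY pinned datum `D` of `X^{rel ∞}(E/K_∞)` (topological
generator `γ`), `D.toDual (f • x) = f ⋆ D.toDual x` with `⋆` the canonical action attached to `conj_γ − 1` on
`Hom(Sel^{rel ∞}(K_∞), ℚ/ℤ)`. [cite: GreenbergLNM1716, §1 p. 60 (after Conj. 1.3)] -/
theorem relaxedSelmerDual_toDual_smul (hγ : κ.IsTopGenerator γ) (D : W.SelmerDualDataRelaxedInf κ γ)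
    (f : IwasawaAlgebra p) (x : D.X) :
    D.toDual (f • x) = (W.isLocNil_conjSelmerInftyRelaxedInf_sub_one κ hγ).smulFun f (D.toDual x) := by
  ext s
  obtain ⟨N, hN⟩ := (W.isLocNil_conjSelmerInftyRelaxedInf_sub_one κ hγ).nil s
  exact relaxedSelmerDual_toDual_smul_apply_of_pow_apply_eq_zero W κ hγ D N s hN f x

/-! ## §2 The restriction `q : X^{rel ∞}(E/K_∞) ↠ X(E/K_∞)` on pinned duals: existence, uniqueness, surjectivity, kernel -/

/-- The inclusion `ι : Sel_{p^∞}(E/K_∞) → Sel^{rel ∞}_{p^∞}(E/K_∞)` intertwines `conj_γ − 1` on both sides (both are restrictions of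
`conj_γ` on `H¹(K_∞, E[p^∞])`). [cite: GreenbergLNM1716, §4 (PDF p. 106)] -/
theorem inclusion_conjSelmerInfty_sub_one (γ : Field.absoluteGaloisGroup K) (s : W.selmerInfty κ) :
    AddSubgroup.inclusion (W.selmerInfty_le_selmerInftyRelaxedInf κ) ((W.conjSelmerInfty κ γ - 1) s) =
      (W.conjSelmerInftyRelaxedInf κ γ - 1) (AddSubgroup.inclusion (W.selmerInfty_le_selmerInftyRelaxedInf κ) s) := by
  rw [IwasawaDual.End_sub_apply, IwasawaDual.End_sub_apply, AddMonoid.End.one_apply, AddMonoid.End.one_apply, map_sub]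
  exact congrArg (· - _) (Subtype.ext rfl)

/-- **The restriction map exists**: for a topological generator `γ`, any pinned `Dr : W.SelmerDualDataRelaxedInf κ γ` and
`D : W.SelmerDualData κ γ`, there is a `Λ`-LINEAR `q : Dr.X → D.X` with `D.toDual (q x) = (Dr.toDual x) ∘ ι` — the Pontryagin dual
`X^{rel ∞}(E/K_∞) → X(E/K_∞)` of `Sel ≤ Sel^{rel ∞}` (on `Dr` it is `toSelmerDual`). `Λ`-linearity: both actions read through `toDual`
are the canonical ones (§1 and `SelmerDualData.toDual_smul`), natural along `ι` (the tree's generic transpose `IwasawaDual.dualLinearMap`).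
[cite: GreenbergLNM1716, §1 p. 60 and §4 Lemma 4.6] [cite: Washington1997, §13.2] -/
theorem exists_relaxedSelmerRestrict (hγ : κ.IsTopGenerator γ) (Dr : W.SelmerDualDataRelaxedInf κ γ) (D : W.SelmerDualData κ γ) :
    ∃ q : Dr.X →ₗ[IwasawaAlgebra p] D.X, ∀ (x : Dr.X) (s : W.selmerInfty κ),
      D.toDual (q x) s = Dr.toDual x (AddSubgroup.inclusion (W.selmerInfty_le_selmerInftyRelaxedInf κ) s) :=
  ⟨IwasawaDual.dualLinearMap D.toDual D.bijective Dr.toDual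
      (AddSubgroup.inclusion (W.selmerInfty_le_selmerInftyRelaxedInf κ))
      (W.isLocNil_conjSelmerInfty_sub_one' κ γ) (W.isLocNil_conjSelmerInftyRelaxedInf_sub_one κ hγ)
      D.toDual_smul (relaxedSelmerDual_toDual_smul W κ hγ Dr) (inclusion_conjSelmerInfty_sub_one W κ γ),
    fun x s ↦ IwasawaDual.toDual_dualHom_apply D.toDual D.bijective Dr.toDual _ x s⟩

/-- **Uniqueness**: two `q`'s compatible with the `toDual`'s agree (`D.toDual` is injective). [folklore] -/
theorem relaxedSelmerRestrict_unique (Dr : W.SelmerDualDataRelaxedInf κ γ) (D : W.SelmerDualData κ γ)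
    (q q' : Dr.X →ₗ[IwasawaAlgebra p] D.X)
    (hq : ∀ (x : Dr.X) (s : W.selmerInfty κ), D.toDual (q x) s =
      Dr.toDual x (AddSubgroup.inclusion (W.selmerInfty_le_selmerInftyRelaxedInf κ) s))
    (hq' : ∀ (x : Dr.X) (s : W.selmerInfty κ), D.toDual (q' x) s =
      Dr.toDual x (AddSubgroup.inclusion (W.selmerInfty_le_selmerInftyRelaxedInf κ) s)) :
    q = q' := by
  refine LinearMap.ext fun x ↦ D.bijective.injective (AddMonoidHom.ext fun s ↦ ?_)
  rw [hq, hq']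

/-- **`q : X^{rel ∞} ↠ X` is ONTO**: every character of `Sel(K_∞)` extends to `Sel^{rel ∞}(K_∞)` along the injective `ι`, because
`ℚ/ℤ` is divisible (Mathlib: `CharacterModule.dual_surjective_of_injective`, Baer). [cite: GreenbergLNM1716, §1 p. 60]
[cite: Washington1997, §13.2] -/
theorem relaxedSelmerRestrict_surjective (Dr : W.SelmerDualDataRelaxedInf κ γ) (D : W.SelmerDualData κ γ)
    (q : Dr.X →ₗ[IwasawaAlgebra p] D.X)
    (hq : ∀ (x : Dr.X) (s : W.selmerInfty κ), D.toDual (q x) s =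
      Dr.toDual x (AddSubgroup.inclusion (W.selmerInfty_le_selmerInftyRelaxedInf κ) s)) :
    Function.Surjective q := by
  intro y
  set ι : W.selmerInfty κ →+ W.selmerInftyRelaxedInf κ :=
    AddSubgroup.inclusion (W.selmerInfty_le_selmerInftyRelaxedInf κ) with hι
  have hinj : Function.Injective ι.toIntLinearMap := AddSubgroup.inclusion_injective (W.selmerInfty_le_selmerInftyRelaxedInf κ)
  obtain ⟨L, hL⟩ := CharacterModule.dual_surjective_of_injective (R := ℤ) ι.toIntLinearMap hinj
    (D.toDual y : CharacterModule (W.selmerInfty κ))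
  obtain ⟨x, hx⟩ := Dr.bijective.surjective (L : W.selmerInftyRelaxedInf κ →+ AddCircle (1 : ℚ))
  refine ⟨x, D.bijective.injective (AddMonoidHom.ext fun s ↦ ?_)⟩
  rw [hq, hx]
  have := congrArg (fun χ : CharacterModule (W.selmerInfty κ) ↦ χ s) hL
  simp only [CharacterModule.dual_apply] at this
  exact this

/-- **The kernel of `q`**: `q x = 0` iff the character `Dr.toDual x` of `Sel^{rel ∞}(K_∞)` VANISHES ON `Sel(K_∞)` — `ker q` is the
Pontryagin dual of `Sel^{rel ∞}/Sel`, the part controlled by the ARCHIMEDEAN conditions only (for `p = 2`, `K = ℚ`, `0 < Δ`: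
`H¹(ℝ, T₂E)⟦Γ⟧ = Λ/2` by [ASP] Thm 6.9 (i) — NOT asserted here). [cite: GreenbergLNM1716, §4 Lemma 4.6 and PDF pp. 106–107] -/
theorem relaxedSelmerRestrict_eq_zero_iff (Dr : W.SelmerDualDataRelaxedInf κ γ) (D : W.SelmerDualData κ γ)
    (q : Dr.X →ₗ[IwasawaAlgebra p] D.X)
    (hq : ∀ (x : Dr.X) (s : W.selmerInfty κ), D.toDual (q x) s =
      Dr.toDual x (AddSubgroup.inclusion (W.selmerInfty_le_selmerInftyRelaxedInf κ) s)) (x : Dr.X) :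
    q x = 0 ↔ ∀ s : W.selmerInfty κ, Dr.toDual x (AddSubgroup.inclusion (W.selmerInfty_le_selmerInftyRelaxedInf κ) s) = 0 := by
  constructor
  · intro h s
    rw [← hq, h, map_zero, AddMonoidHom.zero_apply]
  · intro h
    have h0 : D.toDual (q x) = D.toDual 0 := by
      rw [map_zero]
      exact AddMonoidHom.ext fun s ↦ by rw [hq, h, AddMonoidHom.zero_apply]
    exact D.bijective.injective h0

/-- **Length bookkeeping**: `ℓ_𝔭(X^{rel ∞}) = ℓ_𝔭(ker q) + ℓ_𝔭(X)` at every prime `𝔭` of `Λ` (additivity on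
`0 → ker q → Dr.X → D.X → 0`). [cite: GreenbergLNM1716, §4 Lemma 4.6] -/
theorem lengthAt_relaxedSelmer_eq_ker_add (Dr : W.SelmerDualDataRelaxedInf κ γ) (D : W.SelmerDualData κ γ)
    (q : Dr.X →ₗ[IwasawaAlgebra p] D.X)
    (hq : ∀ (x : Dr.X) (s : W.selmerInfty κ), D.toDual (q x) s =
      Dr.toDual x (AddSubgroup.inclusion (W.selmerInfty_le_selmerInftyRelaxedInf κ) s))
    (𝔭 : PrimeSpectrum (IwasawaAlgebra p)) :
    Module.lengthAt (IwasawaAlgebra p) Dr.X 𝔭 =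
      Module.lengthAt (IwasawaAlgebra p) (LinearMap.ker q) 𝔭 + Module.lengthAt (IwasawaAlgebra p) D.X 𝔭 :=
  Module.lengthAt_eq_add_of_exact (LinearMap.ker q).subtype q (Submodule.injective_subtype _)
    (relaxedSelmerRestrict_surjective W κ Dr D q hq) (LinearMap.exact_subtype_ker_map q) 𝔭

end Forced

/-! ## §3 The two DISPLAYED TEXTS of the relaxed road on the cell [`ρ̄₂` onto ∧ `0 < Δ`] -/

/-- [MEMO tier, OPEN — a reading, nothing asserted] **R⁺ — Kato's GENUINE zeta classes in RELAXED-at-`∞` Coleman coordinates at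
`p = 2` on the cell [`ρ̄₂` onto ∧ `0 < Δ`], ι-keyed.** For every globally minimal `W`, good ordinary at `2`, `ρ̄_{W,2}` onto, `0 < Δ_W`,
its newform `f`, the cyclotomic `(κ, γ)`, every RELAXED Selmer dual datum `Dr` (`X^{rel} = X(Sel^{rel ∞}(W/ℚ_∞))`, no condition at
the real places; Literature `SelmerDualDataRelaxedInf`) and relaxed fine datum `Yr` (`X₀^{rel}`): a pinned `𝐇¹` `I`, `Z ⊆ 𝐇¹` inside
the span of GENUINE `2`-adic Euler-system classes, an ideal `P ⊆ Λ` (Coleman image, Prop. 17.11), a `Λ`-linear `ℓ : 𝐇¹ → P`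
(Coleman ∘ loc₂), an `ι`-SEMILINEAR column map `τ : P →ₛₗ[ι] X^{rel}` killing `ℓ(Z)` (Poitou–Tate for (`H¹_f` at `2`; `0` at real) ⊂
(full at `2`; `0` at real) on the `T`-side — Kato's corestricted classes ARE trivial at the real places, `ℚ(ζ_{2^m})` being totally
imaginary, [ASP] 6.9 (ii)) with image `ker(X^{rel} ↠ X₀^{rel})` (`π` onto, `Function.Exact τ π`), and the GENUINE image clause at
`(2)`: for every `G₁` with `ι G₁ = L₂(f, α)` some `s ∉ (2)` has `s·(2·G₁) ∈ ℓ(Z)` — Kato's classes are booked at `c_∞·L₂^{tree}`,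
`c_∞ = 2` on a rectangular lattice (lead F-27a; Thm 16.2/16.6). VERBATIM the body of F1μι⁻ `ZetaColemanMuIotaNegDiscAtTwo` with
`0 < W.Δ` for `W.Δ < 0`, the carriers `(D, Y)` replaced by the relaxed `(Dr, Yr)` and `G₁` by `2·G₁` in the image clause. Witness
at memo tier: KATO'S OWN SYSTEM (no half class). NOT in print as stated (Kato 17.11 / 16.6 / (17.13.1) at `p = 2` with the
relaxed-at-`∞` structures); NOT a Literature fact; nothing asserted.
[cite: Kato2004Asterisque, Thm. 12.6 (p. 222), Thm. 16.6 (p. 271), Prop. 17.11 (p. 277), §17.13 (pp. 279–280) (shape only; nothing asserted)] -/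
@[conjecture] def RelaxedZetaColemanIotaPosDiscAtTwo : Prop :=
  ∀ (W : WeierstrassCurve ℚ) [W.IsElliptic] [W.IsGloballyMinimal]
      [ContinuousSMul ℤ_[2] (W.tateModule 2)] [Module.Free ℤ_[2] (W.tateModule 2)]
      [Module.Finite ℤ_[2] (W.tateModule 2)] {N : ℕ} [NeZero N] (f : CuspForm (Gamma0 N) 2)
      (κ : ZpExtension ℚ 2) (γ : absoluteGaloisGroup ℚ) (hκ : κ.IsCyclotomic),
      IsOrdinaryAt W 2 → W.HasSurjectiveModNGaloisRep 2 → 0 < W.Δ →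
      κ.IsTopGenerator γ → IsCyclotomicVariable 2 γ → IsNewformOf W f →
      ∀ (Dr : W.SelmerDualDataRelaxedInf κ γ) (Yr : W.FineSelmerDualDataRelaxedInf κ γ),
        ∃ (I : IwasawaH1Data W 2 κ γ)
          (Z : Submodule (IwasawaAlgebra 2) I.H) (P : Submodule (IwasawaAlgebra 2) (IwasawaAlgebra 2))
          (ℓ : I.H →ₗ[IwasawaAlgebra 2] P)
          (τ : P →ₛₗ[((IwasawaAlgebra.involEquiv 2).toRingEquiv : IwasawaAlgebra 2 →+* IwasawaAlgebra 2)] Dr.X)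
          (π : Dr.X →ₗ[IwasawaAlgebra 2] Yr.X),
          Z ≤ Submodule.span (IwasawaAlgebra 2) {s : I.H | IsEulerSystemClassTwo W hκ I s} ∧
          (∀ z ∈ Z, τ (ℓ z) = 0) ∧ Function.Surjective π ∧ Function.Exact τ π ∧
          ∀ G₁ : IwasawaAlgebra 2,
            iwasawaToPowerSeries 2 G₁ = padicLFunction f (unitRoot W 2 : ℚ_[2]) →
              ∃ s : IwasawaAlgebra 2, s ∉ IwasawaAlgebra.augIdealP 2 ∧
                s * (PowerSeries.C (((2 : ℕ) : ℤ_[2]) ^ 1) * G₁) ∈ Submodule.map (P.subtype ∘ₗ ℓ) Z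

/-- `RelaxedZetaColemanIotaPosDiscAtTwo` unfolds to its displayed body. [folklore] -/
theorem relaxedZetaColemanIotaPosDiscAtTwo_iff : RelaxedZetaColemanIotaPosDiscAtTwo ↔
    ∀ (W : WeierstrassCurve ℚ) [W.IsElliptic] [W.IsGloballyMinimal]
      [ContinuousSMul ℤ_[2] (W.tateModule 2)] [Module.Free ℤ_[2] (W.tateModule 2)]
      [Module.Finite ℤ_[2] (W.tateModule 2)] {N : ℕ} [NeZero N] (f : CuspForm (Gamma0 N) 2)
      (κ : ZpExtension ℚ 2) (γ : absoluteGaloisGroup ℚ) (hκ : κ.IsCyclotomic),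
      IsOrdinaryAt W 2 → W.HasSurjectiveModNGaloisRep 2 → 0 < W.Δ →
      κ.IsTopGenerator γ → IsCyclotomicVariable 2 γ → IsNewformOf W f →
      ∀ (Dr : W.SelmerDualDataRelaxedInf κ γ) (Yr : W.FineSelmerDualDataRelaxedInf κ γ),
        ∃ (I : IwasawaH1Data W 2 κ γ)
          (Z : Submodule (IwasawaAlgebra 2) I.H) (P : Submodule (IwasawaAlgebra 2) (IwasawaAlgebra 2))
          (ℓ : I.H →ₗ[IwasawaAlgebra 2] P)
          (τ : P →ₛₗ[((IwasawaAlgebra.involEquiv 2).toRingEquiv : IwasawaAlgebra 2 →+* IwasawaAlgebra 2)] Dr.X)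
          (π : Dr.X →ₗ[IwasawaAlgebra 2] Yr.X),
          Z ≤ Submodule.span (IwasawaAlgebra 2) {s : I.H | IsEulerSystemClassTwo W hκ I s} ∧
          (∀ z ∈ Z, τ (ℓ z) = 0) ∧ Function.Surjective π ∧ Function.Exact τ π ∧
          ∀ G₁ : IwasawaAlgebra 2,
            iwasawaToPowerSeries 2 G₁ = padicLFunction f (unitRoot W 2 : ℚ_[2]) →
              ∃ s : IwasawaAlgebra 2, s ∉ IwasawaAlgebra.augIdealP 2 ∧
                s * (PowerSeries.C (((2 : ℕ) : ℤ_[2]) ^ 1) * G₁) ∈ Submodule.map (P.subtype ∘ₗ ℓ) Z :=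
  Iff.rfl

/-- [RESERVE tier ([ASP] Thm 6.9 (i), UPHELD), OPEN in the kernel — nothing asserted] **Aʳ — the ARCHIMEDEAN `Λ/2` on good-ordinary
two-real-component curves.** For every globally minimal `W`, good ordinary at `2`, with `0 < Δ_W` (two real components, `E[2] ⊂ E(ℝ)`; ANY
image of `ρ̄₂`), the cyclotomic `(κ, γ)`, every Selmer dual datum `D` (`X`, STRICT at `∞`) and relaxed datum `Dr` (`X^{rel}`), and every
`Λ`-linear `q : X^{rel} → X` compatible with the dualities (`D.toDual (q x) = Dr.toDual x ∘ ι`, the restriction of characters — it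
exists, is unique and onto, §2): `Λ/(2)` EMBEDS `Λ`-linearly into `ker q = (Sel^{rel ∞}/Sel)^∨`. Reading: Poitou–Tate for (`H¹_f` at
`2`; `0` at real) ⊂ (`H¹_f` at `2`; full at real) with `𝐇¹_f(T₂W) = 0` (Sel cotorsion, Kato 17.4 (1) at `2`) gives `(Sel^{rel}/Sel)^∨ ≅
lim ⊕_{w∣∞} H¹(ℚ_{n,w}, T₂W) = H¹(ℝ, T₂W)⟦Γ⟧ = Λ/2` for `0 < Δ` (`T₂W ≅ ℤ₂(+) ⊕ ℤ₂(−)` as a `Gal(ℂ/ℝ)`-module), `= 0` for `Δ < 0`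
— «every compatible family of signs at the real places of the `ℚ_n` is realised by relaxed Selmer classes»; hence
`μ(X^{rel}) = μ(X) + ord₂ c_∞`. The reserve paper [ASP] Thm 6.9 (i) (UPHELD 2026-08-08); Greenberg LNM 1716 §4 Lemma 4.6 / Prop 5.8
for the archimedean factor. NOT a Literature fact; nothing asserted.
[cite: GreenbergLNM1716, §4 Lemma 4.6 and PDF pp. 105–107, Prop. 5.8 (shape only; nothing asserted)] [cite: Kato2004Asterisque, Thm. 17.4 (1) (p. 273) (shape)] -/
@[conjecture] def ArchimedeanLambdaModTwoOrdAtTwo : Prop :=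
  ∀ (W : WeierstrassCurve ℚ) [W.IsElliptic] [W.IsGloballyMinimal]
      (κ : ZpExtension ℚ 2) (γ : absoluteGaloisGroup ℚ), κ.IsCyclotomic →
      IsOrdinaryAt W 2 → 0 < W.Δ → κ.IsTopGenerator γ →
      ∀ (D : W.SelmerDualData κ γ) (Dr : W.SelmerDualDataRelaxedInf κ γ) (q : Dr.X →ₗ[IwasawaAlgebra 2] D.X),
        (∀ (x : Dr.X) (s : W.selmerInfty κ),
          D.toDual (q x) s = Dr.toDual x (AddSubgroup.inclusion (W.selmerInfty_le_selmerInftyRelaxedInf κ) s)) →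
        ∃ j : (IwasawaAlgebra 2 ⧸ IwasawaAlgebra.augIdealP 2) →ₗ[IwasawaAlgebra 2] LinearMap.ker q, Function.Injective j

/-- `ArchimedeanLambdaModTwoOrdAtTwo` unfolds to its displayed body. [folklore] -/
theorem archimedeanLambdaModTwoOrdAtTwo_iff : ArchimedeanLambdaModTwoOrdAtTwo ↔
    ∀ (W : WeierstrassCurve ℚ) [W.IsElliptic] [W.IsGloballyMinimal]
      (κ : ZpExtension ℚ 2) (γ : absoluteGaloisGroup ℚ), κ.IsCyclotomic →
      IsOrdinaryAt W 2 → 0 < W.Δ → κ.IsTopGenerator γ →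
      ∀ (D : W.SelmerDualData κ γ) (Dr : W.SelmerDualDataRelaxedInf κ γ) (q : Dr.X →ₗ[IwasawaAlgebra 2] D.X),
        (∀ (x : Dr.X) (s : W.selmerInfty κ),
          D.toDual (q x) s = Dr.toDual x (AddSubgroup.inclusion (W.selmerInfty_le_selmerInftyRelaxedInf κ) s)) →
        ∃ j : (IwasawaAlgebra 2 ⧸ IwasawaAlgebra.augIdealP 2) →ₗ[IwasawaAlgebra 2] LinearMap.ker q, Function.Injective j :=
  Iff.rfl

/-! ## §4 DOORS: R⁺ + Aʳ feed the relaxed `μ`-door; the cell's conjunct and the PAIR child BY NAME -/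

/-- **R⁺ + Aʳ ⟹ the relaxed data of the door `ordKatoHalfAtTwoIsoPosDisc_of_relaxedColeman_of_relaxedConjA`** (`Xr := Dr.X` for the
CONSTRUCTED relaxed datum w.r.t. `γ`, `θ = ι`, `M := ℓ(Z)`, `e = 1`, archimedean clause from the extension `Λ/2 ↪ ker q`, `q` the
restriction of §2; the span clause is dropped — the `μ`-door does not use genuineness). [folklore] -/
theorem relaxedColemanData_of_relaxedZeta_of_arch (hR : RelaxedZetaColemanIotaPosDiscAtTwo)
    (hA : ArchimedeanLambdaModTwoOrdAtTwo) :
    ∀ (W : WeierstrassCurve ℚ) [W.IsElliptic] [W.IsGloballyMinimal]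
      {N : ℕ} [NeZero N] (f : CuspForm (Gamma0 N) 2) (κ : ZpExtension ℚ 2) (γ : absoluteGaloisGroup ℚ),
      κ.IsCyclotomic → IsOrdinaryAt W 2 → W.HasSurjectiveModNGaloisRep 2 → 0 < W.Δ →
      κ.IsTopGenerator γ → IsCyclotomicVariable 2 γ → IsNewformOf W f →
      ∀ (D : W.SelmerDualData κ γ) (Yr : W.FineSelmerDualDataRelaxedInf κ γ),
        ∃ (Xr : Type) (_ : AddCommGroup Xr) (_ : Module (IwasawaAlgebra 2) Xr)
          (θ : IwasawaAlgebra 2 ≃+* IwasawaAlgebra 2) (P : Submodule (IwasawaAlgebra 2) (IwasawaAlgebra 2))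
          (M : Submodule (IwasawaAlgebra 2) P)
          (τ : P →ₛₗ[(θ : IwasawaAlgebra 2 →+* IwasawaAlgebra 2)] Xr) (π : Xr →ₗ[IwasawaAlgebra 2] Yr.X) (e : ℕ),
          (∀ m ∈ M, τ m = 0) ∧ Function.Surjective π ∧ Function.Exact τ π ∧
          Module.lengthAt (IwasawaAlgebra 2) D.X
              ⟨IwasawaAlgebra.augIdealP 2, IwasawaAlgebra.isPrime_augIdealP_holds 2⟩ + e ≤
            Module.lengthAt (IwasawaAlgebra 2) Xr ⟨IwasawaAlgebra.augIdealP 2, IwasawaAlgebra.isPrime_augIdealP_holds 2⟩ ∧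
          ∀ G₁ : IwasawaAlgebra 2, iwasawaToPowerSeries 2 G₁ = padicLFunction f (unitRoot W 2 : ℚ_[2]) →
            ∃ s : IwasawaAlgebra 2, s ∉ IwasawaAlgebra.augIdealP 2 ∧
              s * (PowerSeries.C (((2 : ℕ) : ℤ_[2]) ^ e) * G₁) ∈ Submodule.map P.subtype M := by
  intro W _ _ N _ f κ γ hκ hord h2 hΔ hγ hγ' hf D Yr
  haveI : ContinuousSMul ℤ_[2] (W.tateModule 2) := TateModule.continuousSMul_padicInt
  haveI : Module.Free ℤ_[2] (W.tateModule 2) := W.module_free_tateModule_holds 2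
  haveI : Module.Finite ℤ_[2] (W.tateModule 2) := W.module_finite_tateModule_holds 2
  -- the CONSTRUCTED relaxed Selmer dual datum and its restriction `q : X^{rel} ↠ X`
  let Dr : W.SelmerDualDataRelaxedInf κ γ := W.selmerDualDataRelaxedInf κ hγ
  obtain ⟨q, hq⟩ := exists_relaxedSelmerRestrict W κ hγ Dr D
  obtain ⟨j, hj⟩ := hA W κ γ hκ hord hΔ hγ D Dr q hq
  obtain ⟨I, Z, P, ℓ, τ, π, -, hτℓ, hπs, hπ, himg⟩ := hR W f κ γ hκ hord h2 hΔ hγ hγ' hf Dr Yr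
  refine ⟨Dr.X, inferInstance, inferInstance, (IwasawaAlgebra.involEquiv 2).toRingEquiv, P, Submodule.map ℓ Z, τ, π, 1,
    ?_, hπs, hπ, lengthAt_add_one_le_of_archExtension q (relaxedSelmerRestrict_surjective W κ Dr D q hq) j hj, fun G₁ hG₁ ↦ ?_⟩
  · rintro _ ⟨z, hz, rfl⟩
    exact hτℓ z hz
  · obtain ⟨s, hs, hsG⟩ := himg G₁ hG₁
    exact ⟨s, hs, by rw [← Submodule.map_comp]; exact hsG⟩

/-- **The `0 < Δ` conjunct `OrdKatoHalfAtTwoIsoPosDisc` BY NAME from R⁺ (genuine relaxed zeta reading, memo), Aʳ (archimedean `Λ/2`,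
reserve), relaxed (A₂) on the cell, Abbes–Ullmo and Kato 17.4 (1)(2) at `2`.** No half class, no Euler-system bound at `2`.
CONDITIONAL on the displayed OPEN statements; nothing closed. [cite: Kato2004Asterisque, Thm. 17.4 (1)(2) (p. 273), §17.13]
[cite: AbbesUllmo1996, Thm. A] [cite: CoatesSujatha2005, Conj. A (shape)] -/
theorem ordKatoHalfAtTwoIsoPosDisc_of_relaxedZeta_of_arch_of_relaxedConjA (hR : RelaxedZetaColemanIotaPosDiscAtTwo)
    (hA : ArchimedeanLambdaModTwoOrdAtTwo)
    (hAr : ∀ (W : WeierstrassCurve ℚ) [W.IsElliptic] [W.IsGloballyMinimal], ¬ W.HasCM → W.analyticRank = 0 →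
      GoodOrd W 2 → W.HasSurjectiveModNGaloisRep 2 → 0 < W.Δ →
      ∀ (κ : ZpExtension ℚ 2) (γ : absoluteGaloisGroup ℚ), κ.IsCyclotomic → κ.IsTopGenerator γ →
      ∀ Yr : W.FineSelmerDualDataRelaxedInf κ γ,
        Module.lengthAt (IwasawaAlgebra 2) Yr.X ⟨IwasawaAlgebra.augIdealP 2, IwasawaAlgebra.isPrime_augIdealP_holds 2⟩ = 0)
    (hAU : abbesUllmo_not_dvd_maninConstant_of_not_dvd_level)
    (h17 : ∀ (V : WeierstrassCurve ℚ) [V.IsElliptic] [V.IsGloballyMinimal] [NeZero (V.conductorNorm ℤ)]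
      (f : CuspForm (Gamma0 (V.conductorNorm ℤ)) 2), kato_divisibility_allPrimes V 2 (f := f)) :
    OrdKatoHalfAtTwoIsoPosDisc :=
  ordKatoHalfAtTwoIsoPosDisc_of_relaxedColeman_of_relaxedConjA (relaxedColemanData_of_relaxedZeta_of_arch hR hA) hAr hAU h17

/-- **The `0 < Δ` conjunct BY NAME in the relaxed road's finest currency: R⁺ (memo) + Aʳ (reserve) + Iw⁺ (Iwasawa's `μ₂ = 0` for
`ℚ(W[2], √−1)`, OPEN) + THREE PRINT facts (Lim 2017 Thm 3.5 at `2` upstairs — a tree named fact —, Abbes–Ullmo, Kato 17.4 (1)(2)).**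
Compare the (ε) door `ordKatoHalfAtTwoIsoPosDisc_of_colemanMu_of_lim_of_classicalMu` (lead g6): there P⁺ = the HALF-class package.
CONDITIONAL; nothing closed. [cite: Kato2004Asterisque, Thm. 17.4 (1)(2), Prop. 17.11, §17.13] [cite: Lim2017FineSelmer, §3 Thm. 3.5]
[cite: AbbesUllmo1996, Thm. A] [cite: Iwasawa1973MuInvariants, §1 (shape)] -/
theorem ordKatoHalfAtTwoIsoPosDisc_of_relaxedZeta_of_arch_of_lim_upstairs_of_classicalMu (hR : RelaxedZetaColemanIotaPosDiscAtTwo)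
    (hA : ArchimedeanLambdaModTwoOrdAtTwo)
    (hLim : Lim2017.thm35_at_two_upstairs_fineSelmer_twoTorsion_finite_of_classicalMuVanishes)
    (hIw : ClassicalMuTwoDivisionFieldAdjoinIOrdPosDisc) (hAU : abbesUllmo_not_dvd_maninConstant_of_not_dvd_level)
    (h17 : ∀ (V : WeierstrassCurve ℚ) [V.IsElliptic] [V.IsGloballyMinimal] [NeZero (V.conductorNorm ℤ)]
      (f : CuspForm (Gamma0 (V.conductorNorm ℤ)) 2), kato_divisibility_allPrimes V 2 (f := f)) :
    OrdKatoHalfAtTwoIsoPosDisc :=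
  ordKatoHalfAtTwoIsoPosDisc_of_relaxedZeta_of_arch_of_relaxedConjA hR hA
    (relaxedConjATwoPosDisc_of_lim_upstairs_of_classicalMu hLim hIw) hAU h17

/-- **The PAIR child `OrdKatoFineZetaAtTwoResidue` (stmt-BirchSwinnertonDyer-24097) BY NAME from F1μι⁻ (conjunct 1 verbatim) and the
relaxed road on conjunct 2**: F1μι⁻ + R⁺ + Aʳ + Iw⁺ + Lim@2 upstairs + Abbes–Ullmo + Kato 17.4 (1)(2)@2. The two memo readings F1μι⁻
(`Δ < 0`) and R⁺ (`0 < Δ`) are now the SAME currency: Kato's genuine zeta classes in ι-keyed Coleman coordinates, on strict resp.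
relaxed-at-`∞` carriers. CONDITIONAL; nothing closed. [cite: Kato2004Asterisque, Thm. 12.6, 16.6, Prop. 17.11, §17.13 (shape)] -/
theorem ordKatoFineZetaAtTwoResidue_of_negDisc_of_relaxedZeta_of_arch (hNeg : ZetaColemanMuIotaNegDiscAtTwo)
    (hR : RelaxedZetaColemanIotaPosDiscAtTwo) (hA : ArchimedeanLambdaModTwoOrdAtTwo)
    (hLim : Lim2017.thm35_at_two_upstairs_fineSelmer_twoTorsion_finite_of_classicalMuVanishes)
    (hIw : ClassicalMuTwoDivisionFieldAdjoinIOrdPosDisc) (hAU : abbesUllmo_not_dvd_maninConstant_of_not_dvd_level)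
    (h17 : ∀ (V : WeierstrassCurve ℚ) [V.IsElliptic] [V.IsGloballyMinimal] [NeZero (V.conductorNorm ℤ)]
      (f : CuspForm (Gamma0 (V.conductorNorm ℤ)) 2), kato_divisibility_allPrimes V 2 (f := f)) :
    OrdKatoFineZetaAtTwoResidue :=
  ordKatoFineZetaAtTwoResidue_of_halves hNeg
    (ordKatoHalfAtTwoIsoPosDisc_of_relaxedZeta_of_arch_of_lim_upstairs_of_classicalMu hR hA hLim hIw hAU h17)

end Summit.BirchSwinnertonDyer.BirchSwinnertonDyer.Theorems.SteinbergFibreAtTwo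

end
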